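import Summits.Ventures.HodgeRepro2.T5InertIwasawa
import Summits.Ventures.HodgeRepro2.T5InertSatakeTransformCompletion

/-!
# The Macdonald–Satake identification on the record's local fields: `χ_π(T₁) = N(v)²(α + α⁻¹) + (N(v) − 1)`
(cell pub-hodge-repro2, seat p3)

Tier-5 N3 support. File 220 proves the identification for the abstract inert-place package; on Mathlib's
completions `K_v ⊆ L_w` of the record's number fields at an inert place the two inert-place hypotheses are
theorems (files 204 / 206 / 214) and `q = N(v)` (file 207), so the spherical vector of the unramified principal
series `I(χ_α)` satisfies **`T₁ f₀ = (N(v)² (α + α⁻¹) + (N(v) − 1)) f₀`**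
(`heckeSMul_cellU_one_eq_smul_param_adicCompletion`); on seat p4's place `ℚ(ζ₃)/ℚ` at `2`:
`T₁ f₀ = (4 (α + α⁻¹) + 1) f₀` (`heckeSMul_cellU_one_eq_smul_param_toy`).

Mathlib + this seat's files 220 / 214 and their imports; no display; no device.
§8(d): uses an L-value-free non-vanishing device: NO.
-/

namespace Summit.Ventures.HodgeRepro2.T5InertSphericalEigenvalueCompletion

open IsDedekindDomain HeightOneSpectrum NumberField
open Summit.Ventures.HodgeRepro2.T5HermitianThreeElements Summit.Ventures.HodgeRepro2.T5UnitaryGroupForm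
  Summit.Ventures.HodgeRepro2.T5UnitaryHeckeAdjoint Summit.Ventures.HodgeRepro2.T5HeckeBasisCells
  Summit.Ventures.HodgeRepro2.T5HeckePermutationModule Summit.Ventures.HodgeRepro2.T5HeckeDoubleCoset
  Summit.Ventures.HodgeRepro2.T5GaloisCartanThree Summit.Ventures.HodgeRepro2.T5InertUnipotentResidue
  Summit.Ventures.HodgeRepro2.T5InertDegreeGalois Summit.Ventures.HodgeRepro2.T5InertPlaceCompletion
  Summit.Ventures.HodgeRepro2.T5InertDegreeAdicCompletion Summit.Ventures.HodgeRepro2.T5InertPrincipalSeries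
  Summit.Ventures.HodgeRepro2.T5InertSatakeTransformCompletion Summit.Ventures.HodgeRepro2.T5InertIwasawa

section Abstract

variable {k V : Type*} [SMul k V]

/-- Replacing the scalar by an equal one. -/
theorem smul_congr_left {c c' : k} (h : c = c') (x : V) : c • x = c' • x := by rw [h]

end Abstract

section Completion

variable {K : Type*} [Field K] [NumberField K] (v : HeightOneSpectrum (RingOfIntegers K))
  {L : Type*} [Field L] [NumberField L] [Algebra K L] (w : HeightOneSpectrum (RingOfIntegers L))
  [w.asIdeal.LiesOver v.asIdeal]
  [IsDiscreteValuationRing (integralClosure (v.adicCompletionIntegers K) (w.adicCompletion L))]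
  [Finite (IsLocalRing.ResidueField (integralClosure (v.adicCompletionIntegers K) (w.adicCompletion L)))]
  [IsFractionRing (integralClosure (v.adicCompletionIntegers K) (w.adicCompletion L)) (w.adicCompletion L)]
  [StarRing (w.adicCompletion L)]
  (σ : (w.adicCompletion L) ≃ₐ[v.adicCompletion K] (w.adicCompletion L))
  (hst : ∀ x : w.adicCompletion L, star x = σ x)
  (he : v.asIdeal.ramificationIdx' w.asIdeal = 1)
  (h2 : Module.finrank (v.adicCompletion K) (w.adicCompletion L) = 2) (hσ : σ ≠ 1)
  {ϖ : v.adicCompletionIntegers K} (hϖ : Irreducible ϖ)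
  (hinert : Irreducible (algebraMap (v.adicCompletionIntegers K) (w.adicCompletionIntegers L) ϖ))
  (u : (v.adicCompletionIntegers K)ˣ) (k : Type*) [Field k] [CharZero k]
  [Finite (MulAction.orbit (hyperspecialSubgroup (integralClosure (v.adicCompletionIntegers K) (w.adicCompletion L))
      (J3 (algebraMap (v.adicCompletionIntegers K) (w.adicCompletion L) (u : v.adicCompletionIntegers K))))
    ((cellU (irreducible_uniformiser (map_maximalIdeal_integralClosure_eq_of_irreducible v w hϖ hinert) hϖ)
        (star_algebraMap_of_star_eq σ hst ϖ)
        (algebraMap (v.adicCompletionIntegers K) (w.adicCompletion L) (u : v.adicCompletionIntegers K)) 1 :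
          formUnitaryGroup (J3 (algebraMap (v.adicCompletionIntegers K) (w.adicCompletion L)
            (u : v.adicCompletionIntegers K)))) :
      formUnitaryGroup (J3 (algebraMap (v.adicCompletionIntegers K) (w.adicCompletion L)
          (u : v.adicCompletionIntegers K))) ⧸
        hyperspecialSubgroup (integralClosure (v.adicCompletionIntegers K) (w.adicCompletion L))
          (J3 (algebraMap (v.adicCompletionIntegers K) (w.adicCompletion L) (u : v.adicCompletionIntegers K)))))]

include hst he h2 hσ hϖ hinert in
/-- **`T₁ f₀ = (N(v)² (α + α⁻¹) + (N(v) − 1)) f₀` on the record's local fields.** -/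
theorem heckeSMul_cellU_one_eq_smul_param_adicCompletion {α : k} (hα : α ≠ 0)
    {f₀ : formUnitaryGroup (J3 (algebraMap (v.adicCompletionIntegers K) (w.adicCompletion L)
      (u : v.adicCompletionIntegers K))) → k}
    (hf₀ : IsInduced (algebraMap (v.adicCompletionIntegers K) (w.adicCompletion L) (u : v.adicCompletionIntegers K))
      (irreducible_uniformiser (map_maximalIdeal_integralClosure_eq_of_irreducible v w hϖ hinert) hϖ)
      (star_algebraMap_of_star_eq σ hst ϖ) k (α * ((Ideal.absNorm v.asIdeal : k) ^ 2)⁻¹) f₀)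
    (hf₀K : f₀ ∈ LevelPositivity.invariants (rightRegular k)
      (hyperspecialSubgroup (integralClosure (v.adicCompletionIntegers K) (w.adicCompletion L))
        (J3 (algebraMap (v.adicCompletionIntegers K) (w.adicCompletion L) (u : v.adicCompletionIntegers K)))))
    (h1 : f₀ 1 = 1) :
    heckeSMul (rightRegular k) (doubleCosetOp k
        (hyperspecialSubgroup (integralClosure (v.adicCompletionIntegers K) (w.adicCompletion L))
          (J3 (algebraMap (v.adicCompletionIntegers K) (w.adicCompletion L) (u : v.adicCompletionIntegers K))))
        (cellU (irreducible_uniformiser (map_maximalIdeal_integralClosure_eq_of_irreducible v w hϖ hinert) hϖ)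
          (star_algebraMap_of_star_eq σ hst ϖ)
          (algebraMap (v.adicCompletionIntegers K) (w.adicCompletion L) (u : v.adicCompletionIntegers K)) 1))
        ⟨f₀, hf₀K⟩ =
      ((Ideal.absNorm v.asIdeal : k) ^ 2 * (α + α⁻¹) + ((Ideal.absNorm v.asIdeal : k) - 1)) • ⟨f₀, hf₀K⟩ := by
  have hq := card_traceZero_eq_absNorm v w σ hst he h2 hσ hϖ hinert
  rw [← hq] at hf₀
  refine (heckeSMul_cellU_one_eq_smul_param' (hstar_of_star_eq σ hst)
    (algebraMap (v.adicCompletionIntegers K) (w.adicCompletion L) (u : v.adicCompletionIntegers K))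
    (star_algebraMap_of_star_eq σ hst (u : v.adicCompletionIntegers K))
    (algebraMap_unit_ne_zero (F := v.adicCompletion K) u) (isInteger_algebraMap (u : v.adicCompletionIntegers K))
    (isInteger_algebraMap_unit_inv u)
    (irreducible_uniformiser (map_maximalIdeal_integralClosure_eq_of_irreducible v w hϖ hinert) hϖ)
    (star_algebraMap_of_star_eq σ hst ϖ) k (exists_trace_lift_adicCompletion v w σ hst he h2 hσ hϖ hinert)
    (exists_residueStar_ne_adicCompletion v w σ hst he h2 hσ hϖ hinert) hα hf₀ hf₀K h1).trans
    (smul_congr_left ?_ _)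
  rw [hq]

end Completion

section Toy

open Summit.Ventures.HodgeRepro2.T5GaussianField Summit.Ventures.HodgeRepro2.T5EisensteinField
  Summit.Ventures.HodgeRepro2.T5EisensteinInertPlace Summit.Ventures.HodgeRepro2.T5GaussianPlace
  Summit.Ventures.HodgeRepro2.T5InertDegreeToy

variable (w : HeightOneSpectrum (RingOfIntegers L₃)) [w.asIdeal.LiesOver v₂.asIdeal]
  [IsDiscreteValuationRing (integralClosure (v₂.adicCompletionIntegers ℚ) (w.adicCompletion L₃))]
  [Finite (IsLocalRing.ResidueField (integralClosure (v₂.adicCompletionIntegers ℚ) (w.adicCompletion L₃)))]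
  [IsFractionRing (integralClosure (v₂.adicCompletionIntegers ℚ) (w.adicCompletion L₃)) (w.adicCompletion L₃)]
  [StarRing (w.adicCompletion L₃)]
  (σ : (w.adicCompletion L₃) ≃ₐ[v₂.adicCompletion ℚ] (w.adicCompletion L₃))
  (hst : ∀ x : w.adicCompletion L₃, star x = σ x) (hσ : σ ≠ 1)
  (u : (v₂.adicCompletionIntegers ℚ)ˣ) (k : Type*) [Field k] [CharZero k]
  [Finite (MulAction.orbit (hyperspecialSubgroup (integralClosure (v₂.adicCompletionIntegers ℚ) (w.adicCompletion L₃))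
      (J3 (algebraMap (v₂.adicCompletionIntegers ℚ) (w.adicCompletion L₃) (u : v₂.adicCompletionIntegers ℚ))))
    ((cellU (irreducible_uniformiser (map_maximalIdeal_integralClosure_eq_of_irreducible v₂ w irreducible_two
          (irreducible_algebraMap_two w)) irreducible_two)
        (star_algebraMap_of_star_eq σ hst (2 : v₂.adicCompletionIntegers ℚ))
        (algebraMap (v₂.adicCompletionIntegers ℚ) (w.adicCompletion L₃) (u : v₂.adicCompletionIntegers ℚ)) 1 :
          formUnitaryGroup (J3 (algebraMap (v₂.adicCompletionIntegers ℚ) (w.adicCompletion L₃)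
            (u : v₂.adicCompletionIntegers ℚ)))) :
      formUnitaryGroup (J3 (algebraMap (v₂.adicCompletionIntegers ℚ) (w.adicCompletion L₃)
          (u : v₂.adicCompletionIntegers ℚ))) ⧸
        hyperspecialSubgroup (integralClosure (v₂.adicCompletionIntegers ℚ) (w.adicCompletion L₃))
          (J3 (algebraMap (v₂.adicCompletionIntegers ℚ) (w.adicCompletion L₃) (u : v₂.adicCompletionIntegers ℚ)))))]

include hst hσ in
/-- **`T₁ f₀ = (4 (α + α⁻¹) + 1) f₀` at the place `2` of `ℚ(ζ₃)`** (`c = α / 4`). -/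
theorem heckeSMul_cellU_one_eq_smul_param_toy {α : k} (hα : α ≠ 0)
    {f₀ : formUnitaryGroup (J3 (algebraMap (v₂.adicCompletionIntegers ℚ) (w.adicCompletion L₃)
      (u : v₂.adicCompletionIntegers ℚ))) → k}
    (hf₀ : IsInduced (algebraMap (v₂.adicCompletionIntegers ℚ) (w.adicCompletion L₃) (u : v₂.adicCompletionIntegers ℚ))
      (irreducible_uniformiser (map_maximalIdeal_integralClosure_eq_of_irreducible v₂ w irreducible_two
        (irreducible_algebraMap_two w)) irreducible_two)
      (star_algebraMap_of_star_eq σ hst (2 : v₂.adicCompletionIntegers ℚ)) k (α * (4 : k)⁻¹) f₀)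
    (hf₀K : f₀ ∈ LevelPositivity.invariants (rightRegular k)
      (hyperspecialSubgroup (integralClosure (v₂.adicCompletionIntegers ℚ) (w.adicCompletion L₃))
        (J3 (algebraMap (v₂.adicCompletionIntegers ℚ) (w.adicCompletion L₃) (u : v₂.adicCompletionIntegers ℚ)))))
    (h1 : f₀ 1 = 1) :
    heckeSMul (rightRegular k) (doubleCosetOp k
        (hyperspecialSubgroup (integralClosure (v₂.adicCompletionIntegers ℚ) (w.adicCompletion L₃))
          (J3 (algebraMap (v₂.adicCompletionIntegers ℚ) (w.adicCompletion L₃) (u : v₂.adicCompletionIntegers ℚ))))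
        (cellU (irreducible_uniformiser (map_maximalIdeal_integralClosure_eq_of_irreducible v₂ w irreducible_two
            (irreducible_algebraMap_two w)) irreducible_two)
          (star_algebraMap_of_star_eq σ hst (2 : v₂.adicCompletionIntegers ℚ))
          (algebraMap (v₂.adicCompletionIntegers ℚ) (w.adicCompletion L₃) (u : v₂.adicCompletionIntegers ℚ)) 1))
        ⟨f₀, hf₀K⟩ =
      (4 * (α + α⁻¹) + 1) • ⟨f₀, hf₀K⟩ := by
  have h4 : ((Ideal.absNorm v₂.asIdeal : k) ^ 2)⁻¹ = (4 : k)⁻¹ := by rw [absNorm_v₂]; norm_num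
  rw [← h4] at hf₀
  refine (heckeSMul_cellU_one_eq_smul_param_adicCompletion v₂ w σ hst (ramificationIdx'_eq_one w) (finrank_eq_two w)
    hσ irreducible_two (irreducible_algebraMap_two w) u k hα hf₀ hf₀K h1).trans (smul_congr_left ?_ _)
  rw [absNorm_v₂]
  norm_num

end Toy

end Summit.Ventures.HodgeRepro2.T5InertSphericalEigenvalueCompletion
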